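import Summits.QuantumFields.BalabanUV.T4Continuum.Support.TermwiseHolderUN

/-!
# TermwiseHolder (part 3/4) — `U(N)`: the background binders from local regularity with an `ℓ²` second-difference
profile; then ONE CALL of each producer of part 2

HONEST FRAMING, PLACEMENT, ABSOLUTE RULE: see part 1/4 (`Support/TermwiseHolder`), whose module docstring governs
this file verbatim: FIXED FINITE four-torus, rung (B)+1, conditional; NOT infinite volume, NOT a mass gap, NOT the
Clay statement; the spine estimate NE7 is NOT PRINTED in [Balaban1984PropagatorsI]–[Balaban1989LargeFieldII] and NOT
proved here; no sentence of print is quoted; every hypothesis is a NAMED binder.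

Contents: §6 `binders_of_locRegProfile` — from `LocReg (V_K) z 5 (a₀ε₁L^{−K}) (a₁ε₁L^{−2K}) (a₂ε₁L^{−2K}·h_K)` at
every site, `L^{−K} ≤ h_K`, `ε₁ ≤ 1` and the smallness: `hαK`, (44), (44∇) with
`α₁(K) = (4a₂ + 100a₀a₁ + 132a₀³)ε₁L^{−2K}h_K`, and the profile (B∇)-type law with `c_{α1} = cOscReg`
(generation 14's `LocReg`, `LocReg.norm_hol_plaq_sub_one_le`, `phiM_osc_le_of_locReg`, `cReg`, `cOscReg`,
`a₀ε₁_le_of_smallness` BY NAME); then `interpolation_averaging_UN_of_locRegProfile`; §7 the ledger theorem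
`goodClause_summable_UN_of_locRegProfile`.  The located background-regularity input of generation 14
(`hAreg`/`hBreg` with third radius `a₂ε₁L^{−3K}`) is thereby RE-TYPED to the third radius `a₂ε₁L^{−2K}·h_K`,
`h ∈ ℓ²`, `L^{−K} ≤ h_K` — see part 1's module docstring for why this is the derivable type and part 4 for the
dictionary with a Hölder exponent `0 < β₀ ≤ 1` (`h_K = (L^{−β₀})^K`).
-/

noncomputable section

open Finset MeasureTheory _root_.Filter _root_.Topology NormedSpace
open scoped BigOperators Matrix.Norms.L2Operator InnerProductSpace

namespace Summit.QuantumFields.BalabanUV.T4Continuum.TermwiseHolder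

open Literature.MathematicalPhysics.QuantumFieldTheory.Balaban1983to89
open T4OutputRate T4RecentScale T4GoodClassBudget T4CauchySum T4Crossover T4TowerRateComposition T4TowerRateDischarge
open T4BoundaryCarrier (BFunctional atFl NE9Fl LipBackgroundFl NE5B)
open T4TermwiseBudget T4TermwiseDeviation T4TermwiseCurrency T4TermwiseBoundary T4TermwiseResidual T4TermwiseAction
open T4TermwiseClassical T4TermwiseQuartic
open T4TermwiseInstantiate (cBCH cBCH_nonneg cSZ cSZ_nonneg)
open T4TermwiseOscillation (cOSC)
open B7Prop1Explicit B7Prop2Explicit T4TermwiseBCH T4TermwiseTorus T4TermwiseUN T4TermwiseChainUN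
open TermwiseBackground

/-! ## §6 `U(N)`, `d = 4`, one tower: the binders `hαK`, (44), (44∇), `hdecay`, and the PROFILE law `hα₁K` of
part 2's producers DERIVED from `LocReg` with second-difference radius `a₂ε₁L^{−2K}·h_K`; then ONE CALL of each
producer -/

section UN

variable {n : Type*} [Fintype n] [DecidableEq n] [Nonempty n]
variable {ι : Type} {σ : Type*} [DecidableEq σ] {l₀ : ℝ} {T : ℕ → Finset σ} {Bad : ℕ → ℝ → Finset σ} {Adm : Set ι}

/-- **THE BACKGROUND BINDERS FROM LOCAL REGULARITY WITH A SECOND-DIFFERENCE PROFILE (one tower).**  If at every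
level `K` (on the good class) the background `V_K` is `LocReg` about every site with radius `5` and bounds
`a₀ε₁L^{−K}`, `a₁ε₁L^{−2K}`, `a₂ε₁L^{−2K}·h_K` for a profile `h` with `L^{−K} ≤ h_K`, `ε₁ ≤ 1` and
`20480·L²·cReg·ε₁ ≤ 1`, then: the smallness `hαK` and (44) hold with `α₀(K) = cReg·ε₁·L^{−2K}` (so the (B)-type law
`hdecay` holds with `c_α = cReg`, by `le_rfl`), and (44∇) holds with `α₁(K) = (4a₂ + 100a₀a₁ + 132a₀³)·ε₁·L^{−2K}·h_K`,
which obeys the PROFILE (B∇)-type law `hα₁K` of part 2 with `c_{α1} = cOscReg` (an identity of powers of `L`).  The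
lower-order products `b₀b₁`, `b₀³ ∝ ε₁^{2,3}L^{−3K}` are absorbed by `L^{−K} ≤ h_K`, `ε₁ ≤ 1`.  Generation 14's
`TermwiseBackground.binders_of_locReg` is the endpoint `h_K = L^{−K}`. [folklore] -/
theorem binders_of_locRegProfile (L : ℕ) (hL : 2 ≤ L)
    (VA : ℕ → ℝ → σ → ι → (B7Prop1Explicit.Site 4 → Fin 4 → (Matrix n n ℂ)ˣ)) {a₀ a₁ a₂ ε₁ : ℝ} {h : ℕ → ℝ}
    (ha₀ : 0 ≤ a₀) (ha₁ : 0 ≤ a₁) (ha₂ : 0 ≤ a₂) (hε₁ : 0 ≤ ε₁) (hε₁1 : ε₁ ≤ 1)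
    (hsmall : 20480 * (L : ℝ) ^ 2 * (cReg a₀ a₁ * ε₁) ≤ 1) (hhK : ∀ K, ((L : ℝ) ^ K)⁻¹ ≤ h K)
    (hreg : ∀ K t, |t| ≤ l₀ → ∀ τ ∈ T K \ Bad K t, ∀ v ∈ Adm, ∀ z : B7Prop1Explicit.Site 4,
      LocReg (VA K t τ v) z 5 (a₀ * ε₁ * ((L : ℝ) ^ K)⁻¹) (a₁ * ε₁ * (((L : ℝ) ^ K)⁻¹) ^ 2)
        (a₂ * ε₁ * (((L : ℝ) ^ K)⁻¹) ^ 2 * h K)) :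
    (∀ K, 0 ≤ cReg a₀ a₁ * ε₁ * (((L : ℝ) ^ K)⁻¹) ^ 2 ∧
      20480 * (L : ℝ) ^ 2 * (cReg a₀ a₁ * ε₁ * (((L : ℝ) ^ K)⁻¹) ^ 2) ≤ 1) ∧
    (∀ K t, |t| ≤ l₀ → ∀ τ ∈ T K \ Bad K t, ∀ v ∈ Adm, ∀ (x : B7Prop1Explicit.Site 4) (κ κ' : Fin 4),
      ‖((hol (VA K t τ v) x (plaqWord κ κ') : (Matrix n n ℂ)ˣ) : Matrix n n ℂ) - 1‖
        ≤ cReg a₀ a₁ * ε₁ * (((L : ℝ) ^ K)⁻¹) ^ 2) ∧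
    (∀ K t, |t| ≤ l₀ → ∀ τ ∈ T K \ Bad K t, ∀ v ∈ Adm, ∀ (P : Fin 4 × Fin 4) (z : B7Prop1Explicit.Site 4) (κ : Fin 4),
      ‖((VA K t τ v z κ : (Matrix n n ℂ)ˣ) : Matrix n n ℂ) * phiM (VA K t τ v) P (z + e κ)
          * (((VA K t τ v z κ)⁻¹ : (Matrix n n ℂ)ˣ) : Matrix n n ℂ) - phiM (VA K t τ v) P z‖
        ≤ (4 * a₂ + 100 * a₀ * a₁ + 132 * a₀ ^ 3) * ε₁ * (((L : ℝ) ^ K)⁻¹) ^ 2 * h K) ∧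
    (∀ K, 0 ≤ (4 * a₂ + 100 * a₀ * a₁ + 132 * a₀ ^ 3) * ε₁ * (((L : ℝ) ^ K)⁻¹) ^ 2 * h K ∧
      (4 * a₂ + 100 * a₀ * a₁ + 132 * a₀ ^ 3) * ε₁ * (((L : ℝ) ^ K)⁻¹) ^ 2 * h K
        ≤ cOscReg L a₀ a₁ a₂ * ε₁ * (((L : ℝ) ^ (K + 1))⁻¹) ^ 2 * h K) := by
  have hL1 : (1 : ℝ) ≤ L := by exact_mod_cast (le_trans one_le_two hL)
  have hLne : (L : ℝ) ≠ 0 := by positivity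
  have hq : ∀ K, 0 ≤ ((L : ℝ) ^ K)⁻¹ ∧ ((L : ℝ) ^ K)⁻¹ ≤ 1 := fun K =>
    ⟨by positivity, inv_le_one_of_one_le₀ (one_le_pow₀ hL1)⟩
  have hc : 0 ≤ cReg a₀ a₁ := cReg_nonneg a₀ ha₁
  have hb : a₀ * ε₁ ≤ 1 / 64 := a₀ε₁_le_of_smallness hL ha₀ ha₁ hε₁ hε₁1 hsmall
  have hb₀ : ∀ K, 0 ≤ a₀ * ε₁ * ((L : ℝ) ^ K)⁻¹ ∧ a₀ * ε₁ * ((L : ℝ) ^ K)⁻¹ ≤ 1 / 64 := fun K =>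
    ⟨mul_nonneg (mul_nonneg ha₀ hε₁) (hq K).1,
      (mul_le_of_le_one_right (mul_nonneg ha₀ hε₁) (hq K).2).trans hb⟩
  have hb₁ : ∀ K, 0 ≤ a₁ * ε₁ * (((L : ℝ) ^ K)⁻¹) ^ 2 := fun K => by have := (hq K).1; positivity
  have he2 : ε₁ ^ 2 ≤ ε₁ := by nlinarith
  have he3 : ε₁ ^ 3 ≤ ε₁ := by nlinarith
  refine ⟨fun K => ⟨by have := (hq K).1; positivity, ?_⟩, fun K t ht τ hτ v hv x κ κ' => ?_,
    fun K t ht τ hτ v hv P z κ => ?_,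
    fun K => ⟨by have := (hq K).1; have := (hq K).1.trans (hhK K); positivity, le_of_eq ?_⟩⟩
  · have h1 : (((L : ℝ) ^ K)⁻¹) ^ 2 ≤ 1 := pow_le_one₀ (hq K).1 (hq K).2
    calc 20480 * (L : ℝ) ^ 2 * (cReg a₀ a₁ * ε₁ * (((L : ℝ) ^ K)⁻¹) ^ 2)
        ≤ 20480 * (L : ℝ) ^ 2 * (cReg a₀ a₁ * ε₁ * 1) := by gcongr
      _ ≤ 1 := by simpa using hsmall
  · refine ((hreg K t ht τ hτ v hv x).norm_hol_plaq_sub_one_le (by norm_num) (hb₀ K).1 (hb₀ K).2 κ κ').trans ?_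
    have hx : 0 ≤ a₀ ^ 2 * (((L : ℝ) ^ K)⁻¹) ^ 2 * (ε₁ - ε₁ ^ 2) :=
      mul_nonneg (by have := (hq K).1; positivity) (by linarith)
    unfold cReg
    nlinarith
  · refine (phiM_osc_le_of_locReg (hreg K t ht τ hτ v hv z) le_rfl (hb₀ K).1 (hb₀ K).2 (hb₁ K) P κ).trans ?_
    have hq0 := (hq K).1
    have he2q : ε₁ ^ 2 * ((L : ℝ) ^ K)⁻¹ ≤ ε₁ * h K := mul_le_mul he2 (hhK K) hq0 hε₁
    have he3q : ε₁ ^ 3 * ((L : ℝ) ^ K)⁻¹ ≤ ε₁ * h K := mul_le_mul he3 (hhK K) hq0 hε₁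
    have hx₁ : 0 ≤ a₀ * a₁ * (((L : ℝ) ^ K)⁻¹) ^ 2 * (ε₁ * h K - ε₁ ^ 2 * ((L : ℝ) ^ K)⁻¹) :=
      mul_nonneg (by positivity) (by linarith)
    have hx₂ : 0 ≤ a₀ ^ 3 * (((L : ℝ) ^ K)⁻¹) ^ 2 * (ε₁ * h K - ε₁ ^ 3 * ((L : ℝ) ^ K)⁻¹) :=
      mul_nonneg (by positivity) (by linarith)
    nlinarith
  · unfold cOscReg
    rw [pow_succ]
    field_simp
    ring

/-- **(U)(L) FOR `U(N)` WILSON TERMS FROM LOCAL REGULARITY WITH AN `ℓ²` SECOND-DIFFERENCE PROFILE — ONE CALL of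
part 2's `interpolation_averaging_UN_profile` with its binders `hαK`, `hA`/`hB` ((44)), `hAosc` ((44∇)), `hcα`,
`hdecay`, `hα₁K` DISCHARGED by `binders_of_locRegProfile` (for run A; for run B only unitarity/periodicity/(44) are
consumed).**  REMAINING hypotheses, BY NAME: the two runs' backgrounds are `U(N)`-valued and `M·L^{K+1}`-periodic
(`hAU`/`hBU`), are `LocReg` about every site with radii `a₀ε₁L^{−K}`, `a₁ε₁L^{−2K}`, `a₂ε₁L^{−2K}·h_K`
(`hAreg`/`hBreg` — the background-regularity INPUT, NOT PRINTED as used here) for a profile `h ∈ ℓ²` dominating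
`L^{−K}` (`hhK`, `hh`), `0 ≤ ε₁ ≤ 1`, the smallness `20480·L²·cReg·ε₁ ≤ 1`, (repr) `hreprU`/`hreprL`, `2 ≤ M`,
`2 ≤ L`, genuine planes.  OUTPUT: the per-term deviation bounds with the explicit majorants
`M⁴·dUP N L #planes cReg cOscReg ε₁ h K`, `M⁴·dLN N L #planes cReg ε₁ K`, nonnegative and SUMMABLE.
NOT NE7, NOT Clay. [folklore] -/
theorem interpolation_averaging_UN_of_locRegProfile {Y YA : Type*} {g : ℕ → ℝ → σ → ι → YA → ℝ}
    {f₁ : ℕ → ℝ → σ → ι → Y → ℝ} {Q : ℕ → ℝ → σ → ι → Y → YA} {yA yB : ℕ → ℝ → σ → ι → Y}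
    {xA : ℕ → ℝ → σ → ι → YA}
    (M L : ℕ) (hM : 2 ≤ M) (hL : 2 ≤ L) (planes : Finset (Fin 4 × Fin 4)) (hplanes : ∀ P ∈ planes, P.1 ≠ P.2)
    (VA VB : ℕ → ℝ → σ → ι → (B7Prop1Explicit.Site 4 → Fin 4 → (Matrix n n ℂ)ˣ))
    {a₀ a₁ a₂ ε₁ : ℝ} {h : ℕ → ℝ}
    (ha₀ : 0 ≤ a₀) (ha₁ : 0 ≤ a₁) (ha₂ : 0 ≤ a₂) (hε₁1 : ε₁ ≤ 1)
    (hsmall : 20480 * (L : ℝ) ^ 2 * (cReg a₀ a₁ * ε₁) ≤ 1)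
    (hhK : ∀ K, ((L : ℝ) ^ K)⁻¹ ≤ h K) (hh : Summable (fun K => h K ^ 2))
    (hAU : ∀ K t, |t| ≤ l₀ → ∀ τ ∈ T K \ Bad K t, ∀ v ∈ Adm,
      (∀ x κ, VA K t τ v x κ ∈ unitaryUnits (Matrix n n ℂ)) ∧ IsPeriodic (M * L ^ K * L) (VA K t τ v))
    (hBU : ∀ K t, |t| ≤ l₀ → ∀ τ ∈ T K \ Bad K t, ∀ v ∈ Adm,
      (∀ x κ, VB K t τ v x κ ∈ unitaryUnits (Matrix n n ℂ)) ∧ IsPeriodic (M * L ^ K * L) (VB K t τ v))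
    (hAreg : ∀ K t, |t| ≤ l₀ → ∀ τ ∈ T K \ Bad K t, ∀ v ∈ Adm, ∀ z : B7Prop1Explicit.Site 4,
      LocReg (VA K t τ v) z 5 (a₀ * ε₁ * ((L : ℝ) ^ K)⁻¹) (a₁ * ε₁ * (((L : ℝ) ^ K)⁻¹) ^ 2)
        (a₂ * ε₁ * (((L : ℝ) ^ K)⁻¹) ^ 2 * h K))
    (hBreg : ∀ K t, |t| ≤ l₀ → ∀ τ ∈ T K \ Bad K t, ∀ v ∈ Adm, ∀ z : B7Prop1Explicit.Site 4,
      LocReg (VB K t τ v) z 5 (a₀ * ε₁ * ((L : ℝ) ^ K)⁻¹) (a₁ * ε₁ * (((L : ℝ) ^ K)⁻¹) ^ 2)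
        (a₂ * ε₁ * (((L : ℝ) ^ K)⁻¹) ^ 2 * h K))
    (hreprU : ∀ K t, |t| ≤ l₀ → ∀ τ ∈ T K \ Bad K t, ∀ v ∈ Adm,
      f₁ K t τ v (yA K t τ v) = ∑ x ∈ pbox planes (M * L ^ K * L), eN (phiU (VA K t τ v) x) ∧
        g K t τ v (xA K t τ v) = ∑ y ∈ pbox planes (M * L ^ K), eN (psiU L (VA K t τ v) y))
    (hreprL : ∀ K t, |t| ≤ l₀ → ∀ τ ∈ T K \ Bad K t, ∀ v ∈ Adm,
      f₁ K t τ v (yB K t τ v) = ∑ x ∈ pbox planes (M * L ^ K * L), eN (phiU (VB K t τ v) x) ∧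
        g K t τ v (Q K t τ v (yB K t τ v)) = ∑ y ∈ pbox planes (M * L ^ K), eN (psiU L (VB K t τ v) y))
    (hε₁ : 0 ≤ ε₁) :
    (∀ K t, |t| ≤ l₀ → ∀ τ ∈ T K \ Bad K t, ∀ v ∈ Adm,
      f₁ K t τ v (yA K t τ v) - g K t τ v (xA K t τ v)
        ≤ (M : ℝ) ^ 4 * dUP (Fintype.card n) L planes.card (cReg a₀ a₁) (cOscReg L a₀ a₁ a₂) ε₁ h K) ∧
    (∀ K t, |t| ≤ l₀ → ∀ τ ∈ T K \ Bad K t, ∀ v ∈ Adm,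
      g K t τ v (Q K t τ v (yB K t τ v)) - f₁ K t τ v (yB K t τ v)
        ≤ (M : ℝ) ^ 4 * dLN (Fintype.card n) L planes.card (cReg a₀ a₁) ε₁ K) ∧
    (∀ K, 0 ≤ dUP (Fintype.card n) L planes.card (cReg a₀ a₁) (cOscReg L a₀ a₁ a₂) ε₁ h K) ∧
    (∀ K, 0 ≤ dLN (Fintype.card n) L planes.card (cReg a₀ a₁) ε₁ K) ∧
    Summable (dUP (Fintype.card n) L planes.card (cReg a₀ a₁) (cOscReg L a₀ a₁ a₂) ε₁ h) ∧
    Summable (dLN (Fintype.card n) L planes.card (cReg a₀ a₁) ε₁) := by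
  obtain ⟨hαK, hA44, hAosc, hα₁K⟩ := binders_of_locRegProfile (l₀ := l₀) (T := T) (Bad := Bad) (Adm := Adm) L hL VA
    ha₀ ha₁ ha₂ hε₁ hε₁1 hsmall hhK hAreg
  obtain ⟨-, hB44, -, -⟩ := binders_of_locRegProfile (l₀ := l₀) (T := T) (Bad := Bad) (Adm := Adm) L hL VB ha₀ ha₁
    ha₂ hε₁ hε₁1 hsmall hhK hBreg
  exact interpolation_averaging_UN_profile (g := g) (f₁ := f₁) (Q := Q) (yA := yA) (yB := yB) (xA := xA)
    (αK := fun K => cReg a₀ a₁ * ε₁ * (((L : ℝ) ^ K)⁻¹) ^ 2)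
    (α₁K := fun K => (4 * a₂ + 100 * a₀ * a₁ + 132 * a₀ ^ 3) * ε₁ * (((L : ℝ) ^ K)⁻¹) ^ 2 * h K)
    (cα := cReg a₀ a₁) (cα₁ := cOscReg L a₀ a₁ a₂) (ε₁ := ε₁)
    M L hM hL planes hplanes VA VB hαK
    (fun K t ht τ hτ v hv =>
      ⟨(hAU K t ht τ hτ v hv).1, (hAU K t ht τ hτ v hv).2, fun x κ κ' _ => hA44 K t ht τ hτ v hv x κ κ'⟩)
    (fun K t ht τ hτ v hv =>
      ⟨(hBU K t ht τ hτ v hv).1, (hBU K t ht τ hτ v hv).2, fun x κ κ' _ => hB44 K t ht τ hτ v hv x κ κ'⟩)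
    (fun K t ht τ hτ v hv P _ z κ => hAosc K t ht τ hτ v hv P z κ)
    (cReg_nonneg a₀ ha₁) (fun K => le_rfl) hα₁K hh hreprU hreprL hε₁

end UN

/-! ## §7 The good-class half with `Summable δ⁗` for G = U(N) Wilson terms, background binders from local regularity
with an `ℓ²` second-difference profile -/

section Ledger

variable {n : Type*} [Fintype n] [DecidableEq n] [Nonempty n]
variable {C : T4BoundaryCarrier.Carriers} {ι : Type} [MeasurableSpace ι] {σ : Type*} [DecidableEq σ] {l₀ vol : ℝ}
  {T : ℕ → Finset σ} {Bad : ℕ → ℝ → Finset σ} {A B : ℕ → ℝ → σ → ℝ} {μ : ℕ → ℝ → σ → Measure ι}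
  {fac bfac rfac : ℕ → ℝ → σ → Finset C.Dom} {Adm : Set ι} {EA : Functional C.toCarriers C.BgA}
  {EB : Functional C.toCarriers C.BgB} {BA : BFunctional C C.BgA} {BB : BFunctional C C.BgB}
  {RA : Functional C.toCarriers C.BgA} {RB : Functional C.toCarriers C.BgB}
  {κ θ' Cr EB₀ CrR R₁ b β' w₀ : ℝ} {κ₀ : ℕ} {gA gB : ℕ → ℕ → ℝ} {gfA gfB : ℕ → ℝ} {gsA gsB : ℕ → ℕ → ℝ}
  {uA : ℕ → ι → C.BgA} {uB : ℕ → ι → C.BgB} {oneA : C.BgA} {oneB : C.BgB}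
  {pend : ℕ → ℝ → σ → ι → C.Fl} {nA nB aA aB wA wB γA γB : ℕ → ℝ → σ → ι → ℝ} {qA qB : ℕ → ℝ}
  {κ₁ S : ℕ → ℝ → σ → ℕ → ℝ} {cW RW : ℕ → ℝ → σ → ℝ} {rw sw rγ zA zB c₀ : ℕ → ℝ} {Cw E a Λ Cl : ℝ}

/-- **THE GOOD-CLASS HALF WITH `Summable δ⁗` FOR G = U(N) WILSON TERMS, BACKGROUND BINDERS FROM LOCAL REGULARITY
WITH AN `ℓ²` SECOND-DIFFERENCE PROFILE: part 2's `goodClause_summable_UN_profile` with `hαK`, `hA`, `hB`, `hAosc`,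
`hcα`, `hdecay`, `hα₁K` SUPPLIED by `binders_of_locRegProfile`.**  Every other ledger binder is carried BY NAME and
VERBATIM (none discharged) — in particular the flow window (0.31) of [Balaban1987RG1] sits in `h031A`/`h031B`; the
`U(N)` term-wise inputs (repr) `hreprU hreprL`, the backgrounds' unitarity/periodicity `hAU hBU`, their LOCAL
REGULARITY `hAreg hBreg` with radii `a₀ε₁L^{−K}`, `a₁ε₁L^{−2K}`, `a₂ε₁L^{−2K}·h_K` (the INPUT that replaces (44),
(44∇) and both decay laws; NOT PRINTED as used here), the profile laws `hhK : L^{−K} ≤ h_K`, `hh : h ∈ ℓ²`,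
`0 ≤ ε₁ ≤ 1`, the smallness `20480·L²·cReg·ε₁ ≤ 1`, `2 ≤ M`, `2 ≤ L`, genuine planes and `M⁴ ≤ vol` are
hypotheses.  OUTPUT: the good clause with `δ⁗` whose action-kind share is
`w₀·(dUP N L #planes cReg cOscReg ε₁ h K + dLN N L #planes cReg ε₁ K)`, and `Summable δ⁗`.  No print is quoted;
nothing printed is asserted; NOT NE7, NOT Clay. [folklore] -/
theorem goodClause_summable_UN_of_locRegProfile {Y YA : Type*} {Sfib : ℕ → ℝ → σ → ι → Set Y}
    {SfibA : ℕ → ℝ → σ → ι → Set YA} {g : ℕ → ℝ → σ → ι → YA → ℝ} {f₁ : ℕ → ℝ → σ → ι → Y → ℝ}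
    {Q : ℕ → ℝ → σ → ι → Y → YA} {yA yB : ℕ → ℝ → σ → ι → Y} {xA : ℕ → ℝ → σ → ι → YA}
    (M L : ℕ) (hMtwo : 2 ≤ M) (hLtwo : 2 ≤ L) (planes : Finset (Fin 4 × Fin 4))
    (hplanes : ∀ P ∈ planes, P.1 ≠ P.2)
    (VA VB : ℕ → ℝ → σ → ι → (B7Prop1Explicit.Site 4 → Fin 4 → (Matrix n n ℂ)ˣ))
    {a₀ a₁ a₂ ε₁ : ℝ} {h : ℕ → ℝ}
    (hUR : ∀ K, URateUpTo K EA EB (gA K) (gB K) (uA K) (uB K) Adm Cr θ' κ) (hCr : 0 ≤ Cr)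
    (hθ'0 : 0 < θ') (hθ'1 : θ' < 1) (hθ'Λ : θ' ≤ Λ) (hΛ1 : 1 ≤ Λ) (hCl : 0 ≤ Cl)
    (hURB : ∀ b ∈ C.admFl, ∀ K, URateUpTo K (atFl BA b) (atFl BB b) (gA K) (gB K) (uA K) (uB K) Adm EB₀ θ' κ)
    (hEB₀ : 0 ≤ EB₀)
    (hURR : ∀ K, URateUpTo K RA RB (gA K) (gB K) (uA K) (uB K) Adm CrR θ' κ) (hCrR : 0 ≤ CrR)
    (hfmtA : ∀ K t τ, A K t τ = ∫ v, (∏ X ∈ fac K t τ,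
      Real.exp (EA (gA K) (uA K v) X - EA (gA K) oneA X)) *
        ((∏ X ∈ bfac K t τ, Real.exp (BA (gA K) (uA K v) (pend K t τ v) X)) * nA K t τ v * qA K *
          ((∏ X ∈ rfac K t τ, Real.exp (RA (gA K) (uA K v) X - RA (gA K) oneA X)) * (Real.exp (-aA K t τ v) * wA K t τ v)))
          ∂(μ K t τ))
    (hfmtB : ∀ K t τ, B K t τ = ∫ v, (∏ X ∈ fac K t τ,
      Real.exp (EB (gB K) (uB K v) X - EB (gB K) oneB X)) *
        ((∏ X ∈ bfac K t τ, Real.exp (BB (gB K) (uB K v) (pend K t τ v) X)) * nB K t τ v * qB K *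
          ((∏ X ∈ rfac K t τ, Real.exp (RB (gB K) (uB K v) X - RB (gB K) oneB X)) * (Real.exp (-aB K t τ v) * wB K t τ v)))
          ∂(μ K t τ))
    (hint : ∀ K t, |t| ≤ l₀ → ∀ τ ∈ T K \ Bad K t,
      Integrable (fun v => (∏ X ∈ fac K t τ, Real.exp (EA (gA K) (uA K v) X - EA (gA K) oneA X)) *
        ((∏ X ∈ bfac K t τ, Real.exp (BA (gA K) (uA K v) (pend K t τ v) X)) * nA K t τ v * qA K *
          ((∏ X ∈ rfac K t τ, Real.exp (RA (gA K) (uA K v) X - RA (gA K) oneA X)) * (Real.exp (-aA K t τ v) * wA K t τ v))))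
          (μ K t τ) ∧
      Integrable (fun v => (∏ X ∈ fac K t τ, Real.exp (EB (gB K) (uB K v) X - EB (gB K) oneB X)) *
        ((∏ X ∈ bfac K t τ, Real.exp (BB (gB K) (uB K v) (pend K t τ v) X)) * nB K t τ v * qB K *
          ((∏ X ∈ rfac K t τ, Real.exp (RB (gB K) (uB K v) X - RB (gB K) oneB X)) * (Real.exp (-aB K t τ v) * wB K t τ v))))
          (μ K t τ))
    (hsc : ∀ K t, |t| ≤ l₀ → ∀ τ ∈ T K \ Bad K t, ∀ X ∈ fac K t τ, C.scale X ≤ K)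
    (hoff : ∀ K t, |t| ≤ l₀ → ∀ τ ∈ T K \ Bad K t, ∀ v, v ∉ Adm →
      (∏ X ∈ fac K t τ, Real.exp (EA (gA K) (uA K v) X - EA (gA K) oneA X)) *
        ((∏ X ∈ bfac K t τ, Real.exp (BA (gA K) (uA K v) (pend K t τ v) X)) * nA K t τ v * qA K *
          ((∏ X ∈ rfac K t τ, Real.exp (RA (gA K) (uA K v) X - RA (gA K) oneA X)) * (Real.exp (-aA K t τ v) * wA K t τ v)))
          = 0 ∧
      (∏ X ∈ fac K t τ, Real.exp (EB (gB K) (uB K v) X - EB (gB K) oneB X)) *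
        ((∏ X ∈ bfac K t τ, Real.exp (BB (gB K) (uB K v) (pend K t τ v) X)) * nB K t τ v * qB K *
          ((∏ X ∈ rfac K t τ, Real.exp (RB (gB K) (uB K v) X - RB (gB K) oneB X)) * (Real.exp (-aB K t τ v) * wB K t τ v)))
          = 0)
    (hS : ∀ K t, |t| ≤ l₀ → ∀ τ ∈ T K \ Bad K t, ∀ v ∈ Adm, ∀ j ≤ K,
      |(∑ X ∈ fac K t τ with C.scale X = j,
          (Real.log (Real.exp (EB (gB K) (uB K v) X - EB (gB K) oneB X))
            - Real.log (Real.exp (EA (gA K) (uA K v) X - EA (gA K) oneA X)))) - κ₁ K t τ j| ≤ S K t τ j)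
    (hM : ∀ K t, |t| ≤ l₀ → ∀ τ ∈ T K \ Bad K t,
      Multiplicity (fac K t τ) C.scale (fun X => Real.exp (-(κ * C.d X))) Cw vol Λ K)
    (hwit : ∀ K, ∃ v₁ ∈ Adm, uA K v₁ = oneA ∧ uB K v₁ = oneB)
    (hvol : 0 ≤ vol) (hE : 0 ≤ E) (ha0 : 0 < a) (ha1 : a < 1)
    (hSle : ∀ K t, |t| ≤ l₀ → ∀ τ ∈ T K \ Bad K t, ∀ j ≤ K, S K t τ j ≤ vol * (E * a ^ (K - j)))
    (hpend : ∀ K t, |t| ≤ l₀ → ∀ τ ∈ T K \ Bad K t, ∀ v ∈ Adm, pend K t τ v ∈ C.admFl)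
    (hBwin : ∀ K t, |t| ≤ l₀ → ∀ τ ∈ T K \ Bad K t, RecentOnly (bfac K t τ) C.scale (jlogOf Cl K) K)
    (hMB : ∀ K t, |t| ≤ l₀ → ∀ τ ∈ T K \ Bad K t,
      Multiplicity (bfac K t τ) C.scale (fun X => Real.exp (-(κ * C.d X))) Cw vol Λ K)
    (hnpos : ∀ K t, |t| ≤ l₀ → ∀ τ ∈ T K \ Bad K t, ∀ v ∈ Adm, 0 < nA K t τ v ∧ 0 < nB K t τ v)
    (hzA : ∀ K t, |t| ≤ l₀ → ∀ τ ∈ T K \ Bad K t, ∀ v ∈ Adm, |Real.log (nA K t τ v)| ≤ vol * zA K)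
    (hzB : ∀ K t, |t| ≤ l₀ → ∀ τ ∈ T K \ Bad K t, ∀ v ∈ Adm, |Real.log (nB K t τ v)| ≤ vol * zB K)
    (hzAs : Summable zA) (hzBs : Summable zB)
    (hq : ∀ K, 0 < qA K ∧ 0 < qB K)
    -- the 𝐑-kind: scales, multiplicity, one-run slice sizes, the flow window of both coupling tables
    (hrsc : ∀ K t, |t| ≤ l₀ → ∀ τ ∈ T K \ Bad K t, ∀ X ∈ rfac K t τ, C.scale X ≤ K)
    (hMR : ∀ K t, |t| ≤ l₀ → ∀ τ ∈ T K \ Bad K t,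
      Multiplicity (rfac K t τ) C.scale (fun X => Real.exp (-(κ * C.d X))) Cw vol Λ K)
    (hRSA : ∀ K t, |t| ≤ l₀ → ∀ τ ∈ T K \ Bad K t, ∀ v ∈ Adm, ∀ j ≤ K,
      |∑ X ∈ rfac K t τ with C.scale X = j, (RA (gA K) (uA K v) X - RA (gA K) oneA X)| ≤ vol * (R₁ * gsA K j ^ κ₀))
    (hRSB : ∀ K t, |t| ≤ l₀ → ∀ τ ∈ T K \ Bad K t, ∀ v ∈ Adm, ∀ j ≤ K,
      |∑ X ∈ rfac K t τ with C.scale X = j, (RB (gB K) (uB K v) X - RB (gB K) oneB X)| ≤ vol * (R₁ * gsB K j ^ κ₀))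
    (hb : 0 < b) (h031A : ∀ K, Step.Discrete031 b β' K (gfA K) (gsA K))
    (h031B : ∀ K, Step.Discrete031 b β' K (gfB K) (gsB K)) (hgsA : ∀ K k, k ≤ K → 0 ≤ gsA K k)
    (hgsB : ∀ K k, k ≤ K → 0 ≤ gsB K k) (hR₁ : 0 ≤ R₁) (hκ₀ : 4 < κ₀)
    -- the ACTION kind from ONE CLASSICAL STEP: (min-A) (Q) (lift) (min-B) (act) (U) (L) (γ)
    (hminA : ∀ K t, |t| ≤ l₀ → ∀ τ ∈ T K \ Bad K t, ∀ v ∈ Adm, IsMinOn (g K t τ v) (SfibA K t τ v) (xA K t τ v))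
    (hQ : ∀ K t, |t| ≤ l₀ → ∀ τ ∈ T K \ Bad K t, ∀ v ∈ Adm, Set.MapsTo (Q K t τ v) (Sfib K t τ v) (SfibA K t τ v))
    (hlift : ∀ K t, |t| ≤ l₀ → ∀ τ ∈ T K \ Bad K t, ∀ v ∈ Adm,
      yA K t τ v ∈ Sfib K t τ v ∧ Q K t τ v (yA K t τ v) = xA K t τ v)
    (hminB : ∀ K t, |t| ≤ l₀ → ∀ τ ∈ T K \ Bad K t, ∀ v ∈ Adm,
      yB K t τ v ∈ Sfib K t τ v ∧ IsMinOn (f₁ K t τ v) (Sfib K t τ v) (yB K t τ v))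
    (hact : ∀ K t, |t| ≤ l₀ → ∀ τ ∈ T K \ Bad K t, ∀ v ∈ Adm,
      aA K t τ v = w₀ * g K t τ v (xA K t τ v) + γA K t τ v ∧
        aB K t τ v = w₀ * f₁ K t τ v (yB K t τ v) + γB K t τ v)
    (hw₀ : 0 ≤ w₀)
    -- (U)(L) PRODUCED for G = U(N) Wilson terms (`interpolation_averaging_UN_of_locRegProfile`): (repr) `hreprU hreprL`,
    -- unitarity/periodicity `hAU hBU`, LOCAL REGULARITY with an `ℓ²` second-difference PROFILE `hAreg hBreg hhK hh`
    -- (from which (44), (44∇), the smallness and both decay laws are DERIVED), `ε₁ ≤ 1`, the smallness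
    -- `20480·L²·cReg·ε₁ ≤ 1`, `hε₁`, and `M⁴ ≤ vol`
    (ha₀ : 0 ≤ a₀) (ha₁ : 0 ≤ a₁) (ha₂ : 0 ≤ a₂) (hε₁1 : ε₁ ≤ 1)
    (hsmall : 20480 * (L : ℝ) ^ 2 * (cReg a₀ a₁ * ε₁) ≤ 1)
    (hhK : ∀ K, ((L : ℝ) ^ K)⁻¹ ≤ h K) (hh : Summable (fun K => h K ^ 2))
    (hAU : ∀ K t, |t| ≤ l₀ → ∀ τ ∈ T K \ Bad K t, ∀ v ∈ Adm,
      (∀ x κ, VA K t τ v x κ ∈ unitaryUnits (Matrix n n ℂ)) ∧ IsPeriodic (M * L ^ K * L) (VA K t τ v))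
    (hBU : ∀ K t, |t| ≤ l₀ → ∀ τ ∈ T K \ Bad K t, ∀ v ∈ Adm,
      (∀ x κ, VB K t τ v x κ ∈ unitaryUnits (Matrix n n ℂ)) ∧ IsPeriodic (M * L ^ K * L) (VB K t τ v))
    (hAreg : ∀ K t, |t| ≤ l₀ → ∀ τ ∈ T K \ Bad K t, ∀ v ∈ Adm, ∀ z : B7Prop1Explicit.Site 4,
      LocReg (VA K t τ v) z 5 (a₀ * ε₁ * ((L : ℝ) ^ K)⁻¹) (a₁ * ε₁ * (((L : ℝ) ^ K)⁻¹) ^ 2)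
        (a₂ * ε₁ * (((L : ℝ) ^ K)⁻¹) ^ 2 * h K))
    (hBreg : ∀ K t, |t| ≤ l₀ → ∀ τ ∈ T K \ Bad K t, ∀ v ∈ Adm, ∀ z : B7Prop1Explicit.Site 4,
      LocReg (VB K t τ v) z 5 (a₀ * ε₁ * ((L : ℝ) ^ K)⁻¹) (a₁ * ε₁ * (((L : ℝ) ^ K)⁻¹) ^ 2)
        (a₂ * ε₁ * (((L : ℝ) ^ K)⁻¹) ^ 2 * h K))
    (hreprU : ∀ K t, |t| ≤ l₀ → ∀ τ ∈ T K \ Bad K t, ∀ v ∈ Adm,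
      f₁ K t τ v (yA K t τ v) = ∑ x ∈ pbox planes (M * L ^ K * L), eN (phiU (VA K t τ v) x) ∧
        g K t τ v (xA K t τ v) = ∑ y ∈ pbox planes (M * L ^ K), eN (psiU L (VA K t τ v) y))
    (hreprL : ∀ K t, |t| ≤ l₀ → ∀ τ ∈ T K \ Bad K t, ∀ v ∈ Adm,
      f₁ K t τ v (yB K t τ v) = ∑ x ∈ pbox planes (M * L ^ K * L), eN (phiU (VB K t τ v) x) ∧
        g K t τ v (Q K t τ v (yB K t τ v)) = ∑ y ∈ pbox planes (M * L ^ K), eN (psiU L (VB K t τ v) y))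
    (hε₁ : 0 ≤ ε₁) (hMvol : ((M : ℝ)) ^ 4 ≤ vol)
    (hγ : ∀ K t, |t| ≤ l₀ → ∀ τ ∈ T K \ Bad K t, ∀ v ∈ Adm, |γB K t τ v - γA K t τ v| ≤ vol * rγ K)
    (hrγ : Summable rγ)
    -- the residual kind after generation 8: (R-w) radii about a centre `cW`, (W-w) the WITNESS log-ratio centred
    (hwpos : ∀ K t, |t| ≤ l₀ → ∀ τ ∈ T K \ Bad K t, ∀ v ∈ Adm, 0 < wA K t τ v ∧ 0 < wB K t τ v)
    (hRw : ∀ K t, |t| ≤ l₀ → ∀ τ ∈ T K \ Bad K t, ∀ v ∈ Adm,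
      |Real.log (wB K t τ v) - Real.log (wA K t τ v) - cW K t τ| ≤ RW K t τ)
    (hRRw : ∀ K t, |t| ≤ l₀ → ∀ τ ∈ T K \ Bad K t, RW K t τ ≤ vol * rw K) (hrw : Summable rw)
    (hWw : ∀ K t, |t| ≤ l₀ → ∀ τ ∈ T K \ Bad K t, ∀ v ∈ Adm, uA K v = oneA → uB K v = oneB →
      |Real.log (wB K t τ v) - Real.log (wA K t τ v) - c₀ K| ≤ vol * sw K)
    (hsw : Summable sw) :
    GoodClause l₀ vol T A B Bad
        (fun K => (max Cw 1 * ((E + Cr) * ∑ x ∈ antidiagonal K, min (a ^ x.2) (θ' ^ x.1 * Λ ^ x.2))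
            + (EB₀ * Cw * windowSum θ' Λ (jlogOf Cl K) K + (zA K + zB K)
              + (max (2 * Cw) 1 * ((∑ p ∈ antidiagonal K, min (R₁ * gsA K p.1 ^ κ₀) (CrR * θ' ^ p.1 * Λ ^ p.2))
                  + ∑ p ∈ antidiagonal K, min (R₁ * gsB K p.1 ^ κ₀) (CrR * θ' ^ p.1 * Λ ^ p.2))
                + (w₀ * (dUP (Fintype.card n) L planes.card (cReg a₀ a₁) (cOscReg L a₀ a₁ a₂) ε₁ h K + dLN (Fintype.card n) L planes.card (cReg a₀ a₁) ε₁ K)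
                  + rγ K + rw K))))
          + (max Cw 1 * ((E + Cr) * ∑ x ∈ antidiagonal K, min (a ^ x.2) (θ' ^ x.1 * Λ ^ x.2)) + (rw K + sw K))) ∧
      Summable (fun K => (max Cw 1 * ((E + Cr) * ∑ x ∈ antidiagonal K, min (a ^ x.2) (θ' ^ x.1 * Λ ^ x.2))
            + (EB₀ * Cw * windowSum θ' Λ (jlogOf Cl K) K + (zA K + zB K)
              + (max (2 * Cw) 1 * ((∑ p ∈ antidiagonal K, min (R₁ * gsA K p.1 ^ κ₀) (CrR * θ' ^ p.1 * Λ ^ p.2))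
                  + ∑ p ∈ antidiagonal K, min (R₁ * gsB K p.1 ^ κ₀) (CrR * θ' ^ p.1 * Λ ^ p.2))
                + (w₀ * (dUP (Fintype.card n) L planes.card (cReg a₀ a₁) (cOscReg L a₀ a₁ a₂) ε₁ h K + dLN (Fintype.card n) L planes.card (cReg a₀ a₁) ε₁ K)
                  + rγ K + rw K))))
          + (max Cw 1 * ((E + Cr) * ∑ x ∈ antidiagonal K, min (a ^ x.2) (θ' ^ x.1 * Λ ^ x.2)) + (rw K + sw K))) := by
  obtain ⟨hαK, hA44, hAosc, hα₁K⟩ := binders_of_locRegProfile (l₀ := l₀) (T := T) (Bad := Bad) (Adm := Adm) L hLtwo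
    VA ha₀ ha₁ ha₂ hε₁ hε₁1 hsmall hhK hAreg
  obtain ⟨-, hB44, -, -⟩ := binders_of_locRegProfile (l₀ := l₀) (T := T) (Bad := Bad) (Adm := Adm) L hLtwo VB ha₀
    ha₁ ha₂ hε₁ hε₁1 hsmall hhK hBreg
  exact goodClause_summable_UN_profile (Sfib := Sfib) (SfibA := SfibA) (g := g) (f₁ := f₁) (Q := Q) (yA := yA)
    (yB := yB)
    (xA := xA) (αK := fun K => cReg a₀ a₁ * ε₁ * (((L : ℝ) ^ K)⁻¹) ^ 2)
    (α₁K := fun K => (4 * a₂ + 100 * a₀ * a₁ + 132 * a₀ ^ 3) * ε₁ * (((L : ℝ) ^ K)⁻¹) ^ 2 * h K)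
    (cα := cReg a₀ a₁) (cα₁ := cOscReg L a₀ a₁ a₂) (ε₁ := ε₁)
    M L hMtwo hLtwo planes hplanes VA VB hUR hCr hθ'0 hθ'1 hθ'Λ hΛ1 hCl hURB hEB₀ hURR hCrR hfmtA hfmtB hint hsc
    hoff hS hM hwit hvol hE ha0 ha1 hSle hpend hBwin hMB hnpos hzA hzB hzAs hzBs hq hrsc hMR hRSA hRSB hb h031A h031B
    hgsA hgsB hR₁ hκ₀ hminA hQ hlift hminB hact hw₀ hαK
    (fun K t ht τ hτ v hv =>
      ⟨(hAU K t ht τ hτ v hv).1, (hAU K t ht τ hτ v hv).2, fun x κ κ' _ => hA44 K t ht τ hτ v hv x κ κ'⟩)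
    (fun K t ht τ hτ v hv =>
      ⟨(hBU K t ht τ hτ v hv).1, (hBU K t ht τ hτ v hv).2, fun x κ κ' _ => hB44 K t ht τ hτ v hv x κ κ'⟩)
    (fun K t ht τ hτ v hv P _ z κ => hAosc K t ht τ hτ v hv P z κ)
    (cReg_nonneg a₀ ha₁) (fun K => le_rfl) hα₁K hh hreprU hreprL hε₁ hMvol hγ hrγ hwpos hRw hRRw hrw hWw hsw

end Ledger

end Summit.QuantumFields.BalabanUV.T4Continuum.TermwiseHolder
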